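import Mathlib
import Summits.Ventures.PercRepro2.Defs
import Summits.Ventures.PercRepro2.Independence
import Summits.Ventures.PercRepro2.Harris
import Summits.Ventures.PercRepro2.Graph
import Summits.Ventures.PercRepro2.Events
import Summits.Ventures.PercRepro2.ZCClusterBlind
import Summits.Ventures.PercRepro2.ZCRootDecomp
import Summits.Ventures.PercRepro2.ZCCondProb
import Summits.Ventures.PercRepro2.ZCThetaPA

/-!
# `(ZC-direct)`, part 1: the fibres over a configuration of `G − a₁` (blind cell PercRepro2, mine-a g29)

The direct-attachment event `U = {{a₁} ∪ N ∈ 𝓔}` (`directEvent`, `N` = the open neighbours of the root)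
and the fibres of events over a configuration `σ₁` of `G − a₁` (`fib`): the fibre of `U` does not see
`σ₁` (`fib_directEvent`), fibres of increasing events are up-sets, the fibre of `{a₁ ↔ x}` is «some edge
of `a₁` into `C'(x)` is open» (`mem_fib_conn_iff`) and depends only on those edges (`dependsOn_fib_conn`),
the edges into `C'(a₃)` and `C'(o)` are disjoint when `a₃ ↮ o` in `G − a₁` (`disjoint_into`), the two
fibres coincide when `a₃ ↔ o` (`fib_conn_eq_of_conn`), and on `{a₁ ↮ a₃}` the cluster of `a₃` is its
cluster in `G − a₁` (`cluster_eq_base_of_not_conn`).  MINE-A.md §83.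
-/

namespace Summit.Ventures.PercRepro2

namespace ZCDirect

variable {V : Type*} {E : Type*} [Fintype V] [DecidableEq V] [Fintype E] [DecidableEq E]
  {R : Type*} [Field R] [LinearOrder R] [IsStrictOrderedRing R]

variable (ends : E → Sym2 V) (a₁ : V)

/-- The direct-attachment event `{{a₁} ∪ N ∈ 𝓔}`, `N` the open neighbours of the root. -/
def directEvent (𝓔 : Set (Set V)) : Set (Config E) :=
  {ω | insert a₁ (openNbr ends ω a₁) ∈ 𝓔}

/-- The fibre of an event over a configuration `σ₁` of `G − a₁`. -/
def fib (A : Set (Config E)) (σ₁ : {e // e ∈ awayEdges ends a₁} → Bool) :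
    Set ({e // e ∉ awayEdges ends a₁} → Bool) :=
  {τ | glue (awayEdges ends a₁) σ₁ τ ∈ A}

/-- The open neighbours of `a₁` read off the edges of `a₁`. -/
def nbrOf (τ : {e // e ∉ awayEdges ends a₁} → Bool) : Set V :=
  {v | ∃ e : {e // e ∉ awayEdges ends a₁}, τ e = true ∧ ends e = s(a₁, v)}

/-- The direct-attachment event on the edges of `a₁`. -/
def fibU (𝓔 : Set (Set V)) : Set ({e // e ∉ awayEdges ends a₁} → Bool) :=
  {τ | insert a₁ (nbrOf ends a₁ τ) ∈ 𝓔}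

/-- The edges of `a₁` into a vertex set `C`. -/
def into (C : Set V) : Set {e // e ∉ awayEdges ends a₁} :=
  {e | ∃ v ∈ C, ends e = s(a₁, v)}

open Classical in
/-- Close the edges of `a₁` into `C`. -/
noncomputable def clearInto (C : Set V) (τ : {e // e ∉ awayEdges ends a₁} → Bool) :
    {e // e ∉ awayEdges ends a₁} → Bool :=
  fun e => if e ∈ into ends a₁ C then false else τ e

omit [Fintype E] [DecidableEq E] in
/-- The fibre of the direct-attachment event does not see `σ₁`. -/
lemma fib_directEvent (𝓔 : Set (Set V)) (σ₁ : {e // e ∈ awayEdges ends a₁} → Bool) :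
    fib ends a₁ (directEvent ends a₁ 𝓔) σ₁ = fibU ends a₁ 𝓔 := by
  ext τ
  simp only [fib, directEvent, fibU, Set.mem_setOf_eq]
  have : openNbr ends (glue (awayEdges ends a₁) σ₁ τ) a₁ = nbrOf ends a₁ τ := by
    ext v
    rw [mem_openNbr_glue_iff]
    rfl
  rw [this]

omit [Fintype V] [DecidableEq V] [Fintype E] [DecidableEq E] in
/-- `nbrOf` is monotone. -/
lemma nbrOf_mono {τ τ' : {e // e ∉ awayEdges ends a₁} → Bool} (h : τ ≤ τ') :
    nbrOf ends a₁ τ ⊆ nbrOf ends a₁ τ' := by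
  rintro v ⟨e, he, hends⟩
  refine ⟨e, ?_, hends⟩
  have := h e
  rw [he] at this
  exact Bool.eq_true_of_true_le this

omit [Fintype V] [DecidableEq V] [Fintype E] [DecidableEq E] in
/-- The direct-attachment fibre is an up-set. -/
lemma isUpperSet_fibU {𝓔 : Set (Set V)} (h𝓔 : IsUpperSet 𝓔) : IsUpperSet (fibU ends a₁ 𝓔) := by
  intro τ τ' h hτ
  exact h𝓔 (Set.insert_subset_insert (nbrOf_mono ends a₁ h)) hτ

omit [Fintype E] [DecidableEq E] in
/-- `glue` is monotone in the second component. -/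
lemma glue_mono_right (σ₁ : {e // e ∈ awayEdges ends a₁} → Bool)
    {τ τ' : {e // e ∉ awayEdges ends a₁} → Bool} (h : τ ≤ τ') :
    glue (awayEdges ends a₁) σ₁ τ ≤ glue (awayEdges ends a₁) σ₁ τ' := by
  intro e
  by_cases he : e ∈ awayEdges ends a₁
  · rw [glue_apply_of_mem _ _ _ he, glue_apply_of_mem _ _ _ he]
  · rw [glue_apply_of_notMem _ _ _ he, glue_apply_of_notMem _ _ _ he]
    exact h _

omit [Fintype E] [DecidableEq E] in
/-- Fibres of increasing events are up-sets. -/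
lemma isUpperSet_fib {A : Set (Config E)} (hA : IsUpperSet A)
    (σ₁ : {e // e ∈ awayEdges ends a₁} → Bool) : IsUpperSet (fib ends a₁ A σ₁) :=
  fun _ _ h hτ => hA (glue_mono_right ends a₁ σ₁ h) hτ

omit [Fintype E] [DecidableEq E] in
/-- The base configuration is below every glued configuration. -/
lemma baseConfig_le (σ₁ : {e // e ∈ awayEdges ends a₁} → Bool)
    (τ : {e // e ∉ awayEdges ends a₁} → Bool) :
    baseConfig ends a₁ σ₁ ≤ glue (awayEdges ends a₁) σ₁ τ :=
  glue_mono_right ends a₁ σ₁ fun _ => Bool.false_le _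

omit [Fintype E] [DecidableEq E] in
/-- The fibre of `{a₁ ↔ x}` (`x ≠ a₁`) is the event that some edge of `a₁` into `C'(x)` is open. -/
lemma mem_fib_conn_iff (σ₁ : {e // e ∈ awayEdges ends a₁} → Bool) {x : V} (hx : x ≠ a₁)
    (τ : {e // e ∉ awayEdges ends a₁} → Bool) :
    τ ∈ fib ends a₁ (connEvent ends a₁ x) σ₁ ↔
      ∃ e ∈ into ends a₁ (cluster ends (baseConfig ends a₁ σ₁) x), τ e = true := by
  simp only [fib, Set.mem_setOf_eq, mem_connEvent]
  change x ∈ cluster ends (glue (awayEdges ends a₁) σ₁ τ) a₁ ↔ _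
  rw [mark_mem_cluster_glue_iff ends a₁ σ₁ τ hx]
  constructor
  · rintro ⟨e, he, v, hv, hends⟩
    exact ⟨e, ⟨v, hv, hends⟩, he⟩
  · rintro ⟨e, ⟨v, hv, hends⟩, he⟩
    exact ⟨e, he, v, hv, hends⟩

omit [Fintype E] [DecidableEq E] in
/-- The fibre of `{a₁ ↔ x}` depends only on the edges into `C'(x)`. -/
lemma dependsOn_fib_conn (σ₁ : {e // e ∈ awayEdges ends a₁} → Bool) {x : V} (hx : x ≠ a₁) :
    DependsOn (· ∈ fib ends a₁ (connEvent ends a₁ x) σ₁)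
      (into ends a₁ (cluster ends (baseConfig ends a₁ σ₁) x)) := by
  intro τ τ' h
  apply propext
  show τ ∈ fib ends a₁ (connEvent ends a₁ x) σ₁ ↔ τ' ∈ fib ends a₁ (connEvent ends a₁ x) σ₁
  rw [mem_fib_conn_iff ends a₁ σ₁ hx, mem_fib_conn_iff ends a₁ σ₁ hx]
  constructor
  · rintro ⟨e, he, hτ⟩
    exact ⟨e, he, by rw [← h e he]; exact hτ⟩
  · rintro ⟨e, he, hτ⟩
    exact ⟨e, he, by rw [h e he]; exact hτ⟩

omit [Fintype E] [DecidableEq E] in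
/-- No vertex of `C'(x)` is `a₁` when `x ≠ a₁`. -/
lemma ne_root_of_mem_cluster_base (σ₁ : {e // e ∈ awayEdges ends a₁} → Bool) {x v : V}
    (hx : x ≠ a₁) (hv : v ∈ cluster ends (baseConfig ends a₁ σ₁) x) : v ≠ a₁ := by
  intro hva
  rw [hva] at hv
  have hdel : baseConfig ends a₁ σ₁ = deleteVertex ends a₁ (baseConfig ends a₁ σ₁) := by
    rw [baseConfig, deleteVertex_glue]
  rw [mem_cluster, hdel] at hv
  exact not_conn_deleteVertex hx hv

omit [Fintype E] [DecidableEq E] in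
/-- When `a₃ ↮ o` in `G − a₁`, the edges into the two blocks are disjoint. -/
lemma disjoint_into (σ₁ : {e // e ∈ awayEdges ends a₁} → Bool) {a₃ o : V} (h3 : a₃ ≠ a₁)
    (hγ : ¬ Conn ends (baseConfig ends a₁ σ₁) a₃ o) :
    Disjoint (into ends a₁ (cluster ends (baseConfig ends a₁ σ₁) a₃))
      (into ends a₁ (cluster ends (baseConfig ends a₁ σ₁) o)) := by
  rw [Set.disjoint_left]
  rintro e ⟨v, hv, hends⟩ ⟨w, hw, hends'⟩
  rw [hends] at hends'
  rcases Sym2.eq_iff.1 hends' with ⟨_, hvw⟩ | ⟨_, hva⟩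
  · subst hvw
    exact hγ (conn_trans hv (conn_symm hw))
  · exact ne_root_of_mem_cluster_base ends a₁ σ₁ h3 hv hva

omit [Fintype E] [DecidableEq E] in
/-- When `a₃ ↔ o` in `G − a₁`, the two fibres coincide. -/
lemma fib_conn_eq_of_conn (σ₁ : {e // e ∈ awayEdges ends a₁} → Bool) {a₃ o : V}
    (hγ : Conn ends (baseConfig ends a₁ σ₁) a₃ o) :
    fib ends a₁ (connEvent ends a₁ a₃) σ₁ = fib ends a₁ (connEvent ends a₁ o) σ₁ := by
  ext τ
  simp only [fib, Set.mem_setOf_eq, mem_connEvent]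
  have hγ' : Conn ends (glue (awayEdges ends a₁) σ₁ τ) a₃ o :=
    conn_mono (baseConfig_le ends a₁ σ₁ τ) hγ
  exact ⟨fun h => conn_trans h hγ', fun h => conn_trans h (conn_symm hγ')⟩

omit [Fintype E] [DecidableEq E] in
/-- On `{a₁ ↮ a₃}` the cluster of `a₃` is its cluster in `G − a₁`. -/
lemma cluster_eq_base_of_not_conn (σ₁ : {e // e ∈ awayEdges ends a₁} → Bool)
    (τ : {e // e ∉ awayEdges ends a₁} → Bool) {a₃ : V}
    (h : ¬ Conn ends (glue (awayEdges ends a₁) σ₁ τ) a₁ a₃) :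
    cluster ends (glue (awayEdges ends a₁) σ₁ τ) a₃ = cluster ends (baseConfig ends a₁ σ₁) a₃ := by
  apply Set.Subset.antisymm
  · intro u hu
    rw [mem_cluster] at hu ⊢
    refine mem_of_conn_of_closed (S := cluster ends (baseConfig ends a₁ σ₁) a₃) ?_
      (mem_cluster_self ends _ a₃) hu
    intro x hx y hxy
    rw [mem_cluster] at hx ⊢
    obtain ⟨_, e, he, hends⟩ := openGraph_adj.1 hxy
    by_cases hem : e ∈ awayEdges ends a₁
    · -- an edge of `G − a₁`, open in the base configuration too
      have he' : baseConfig ends a₁ σ₁ e = true := by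
        rw [glue_apply_of_mem _ _ _ hem] at he
        rw [baseConfig, glue_apply_of_mem _ _ _ hem]; exact he
      exact conn_trans hx (conn_of_openAdj ⟨e, he', hends⟩)
    · -- an edge at `a₁`: impossible on `{a₁ ↮ a₃}`
      exfalso
      have hle := baseConfig_le ends a₁ σ₁ τ
      have hx' : x ≠ a₁ := fun hxa => by
        rw [hxa] at hx
        exact h (conn_symm (conn_mono hle hx))
      have hmem : e ∈ touches ends (↑({a₁} : Finset V) : Set V) := by
        simpa [awayEdges] using hem
      obtain ⟨z, hz, w, hzw⟩ := hmem
      simp only [Finset.coe_singleton, Set.mem_singleton_iff] at hz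
      rw [hz, hends] at hzw
      rcases Sym2.eq_iff.1 hzw with ⟨hxa, _⟩ | ⟨_, hya⟩
      · exact hx' hxa
      · -- `y = a₁`: then `a₁ ↔ x ↔ a₃`
        have hends' : ends e = s(x, a₁) := by rw [hends, hya]
        have hxy' : Conn ends (glue (awayEdges ends a₁) σ₁ τ) x a₁ :=
          conn_of_openAdj ⟨e, he, hends'⟩
        exact h (conn_trans (conn_symm hxy') (conn_symm (conn_mono hle hx)))
  · exact cluster_mono (baseConfig_le ends a₁ σ₁ τ) a₃


end ZCDirect

end Summit.Ventures.PercRepro2
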